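import Summits.QuantumAdvantage.QuantumAdvantage.Theorems.WbwObfuscatedGluedTreesKowPhPrograms

/-!
# `WbwObfuscatedGluedTrees` (stmt-QuantumAdvantage-2340) — line `knowledge-of-walk-split`, STAGE 7 (the PRF hybrid):
# auxiliary lemmas for the semantics of the layer-C program (registered toolkit stub `toolkit_phWalkSemAux`)

Pure-data lemmas used by the proof of `stub_walkSem` (file `…KowPhWalkSem`): the layer-C program `walkQ Λ` /
`walkOut Λ` of `KowPhPrograms` §5 reads the fields of a label (`labDepth`, `labIdx`), assembles the neighbour labels
(`nbrLabels`), reads the cycle atom of a leaf by three keyed-permutation requests (`prpBodies`) and sorts names by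
binary value (`sortByVal`); here these are identified with the tree's vocabulary:

* §1 binary digits (`bitsOf`, `bitsToNat`, `vecOf`, `nameVal`);
* §2 the leaf permutations `leafPerm = (bitVecEquiv d).permCongr prp` on numerals and the cycle successor /
  predecessor (`finRotate`);
* §3 the label fields of a vertex and `nbrLabels d (label d v) p₂ p₃ =` the labels of the parent, the children or the
  two cross leaves (`cross₁`, `cross₂`), given that `p₂`, `p₃` carry the cross positions;
* §4 the three permutation answers of `prpBodies` at a leaf ARE the cross positions of `codeCycle T d`
  (`crossL` / `crossR` of `GluedTreesThm9Defs`);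
* §5 `sortByVal = List.insertionSort (· ≤ ·  on bitsToNat)` (the registered toolkit stub);
* §6 the glued-trees oracle at an honest name (the insertion sort of the encrypted neighbour labels) and at a string
  naming no vertex (`[]`), the halves of a `2N`-bit query, and the all-invalid answer string.

Several lemmas are adapted from the private lemmas of toolkit `NbrBitFP` (files `…KowNbrLabels`, `…KowNbrOracle`).

[folklore] (objects: ChildsEtAl2003 §2 / §4 Game 1; LubyRackoff1988; Goldreich2004FoC2 Constructions 5.3.9 / 5.4.19).
-/

set_option linter.dupNamespace false

noncomputable section

namespace Summit.QuantumAdvantage.QuantumAdvantage.Theorems.WbwObfuscatedGluedTrees.KnowledgeOfWalk.PrfHybrid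

open Literature.Computability.Complexity Literature.Computability.QuantumComplexity
open Literature.Computability.QuantumComplexity.GluedTrees
open Literature.Computability.Cryptography Literature.Computability.Cryptography.ObfuscatedGluedTrees
open Summit.QuantumAdvantage.QuantumAdvantage.Theorems.WbwObfuscatedGluedTrees.KnowledgeOfWalk.BlackBox
open Summit.QuantumAdvantage.QuantumAdvantage.Theorems.WbwObfuscatedGluedTrees.KnowledgeOfWalk.RealIdeal
open _root_.Computability

variable {d : ℕ}

/-! ### §1 Binary digits -/

/-- `bitsOf w` is inverted by `bitsToNat` below `2^w` (adapted from toolkit `NbrBitFP`, piece G3). [folklore] -/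
theorem walkSem_bitsToNat_bitsOf {w m : ℕ} (h : m < 2 ^ w) : bitsToNat (bitsOf w m) = m := by
  refine Nat.eq_of_testBit_eq fun t => ?_
  rw [Com.testBit_bitsToNat]
  by_cases ht : t < w
  · simp [bitsOf, ht]
  · rw [List.getD_eq_default _ _ (by simpa using not_lt.1 ht),
      Nat.testBit_lt_two_pow (h.trans_le (Nat.pow_le_pow_right two_pos (not_lt.1 ht)))]

/-- Reading `bitsOf w m` as a `w`-bit vector gives the binary digits of `m`. [folklore] -/
theorem walkSem_vecOf_bitsOf (w m : ℕ) : vecOf w (bitsOf w m) = fun t : Fin w => m.testBit t := by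
  funext t
  show (bitsOf w m).getD t false = _
  simp [bitsOf]

/-- `bitsToNat (List.ofFn a) = nameVal a` (both little-endian; adapted from toolkit `NbrBitFP`, piece G5). [folklore] -/
theorem walkSem_bitsToNat_ofFn : ∀ {N : ℕ} (a : Fin N → Bool), bitsToNat (List.ofFn a) = nameVal a
  | 0, a => by simp [nameVal]
  | N + 1, a => by
    rw [List.ofFn_succ, bitsToNat_cons, walkSem_bitsToNat_ofFn, nameVal, nameVal, Fin.sum_univ_succ]
    simp only [Fin.val_zero, pow_zero, mul_one, Fin.val_succ, pow_succ, Finset.mul_sum]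
    congr 1
    exact Finset.sum_congr rfl fun i _ => by ring

/-! ### §2 The leaf permutations on numerals -/

/-- The inverse bit-vector equivalence reads binary digits (adapted from toolkit `NbrBitFP`, piece G3). [folklore] -/
theorem walkSem_bitVecEquiv_symm_apply (κ : Fin (2 ^ d)) :
    (bitVecEquiv d).symm κ = fun t : Fin d => (κ : ℕ).testBit t := by
  funext t
  simp [bitVecEquiv, finTwoEquiv, Nat.testBit_eq_decide_div_mod_eq, Fin.ext_iff, Bool.beq_eq_decide_eq,
    finFunctionFinEquiv_symm_apply_val]

/-- The value of a bit vector under `bitVecEquiv` is `bitsToNat` of its list (adapted from toolkit `NbrBitFP`,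
piece G3). [folklore] -/
theorem walkSem_val_bitVecEquiv (x : Fin d → Bool) :
    ((bitVecEquiv d x : Fin (2 ^ d)) : ℕ) = bitsToNat (List.ofFn x) := by
  have hlt : bitsToNat (List.ofFn x) < 2 ^ d := by simpa using bitsToNat_lt (List.ofFn x)
  suffices h : bitVecEquiv d x = ⟨_, hlt⟩ by rw [h]
  rw [Equiv.apply_eq_iff_eq_symm_apply, walkSem_bitVecEquiv_symm_apply]
  funext t
  simp [Com.testBit_bitsToNat, List.getD_eq_getElem?_getD]

/-- `bitsOf d κ` read as a `d`-bit vector is the bit vector of `κ`. [folklore] -/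
theorem walkSem_vecOf_bitsOf_fin (κ : Fin (2 ^ d)) : vecOf d (bitsOf d κ) = (bitVecEquiv d).symm κ := by
  rw [walkSem_vecOf_bitsOf, walkSem_bitVecEquiv_symm_apply]

/-- The inverse of a transported permutation, pointwise. [folklore] -/
theorem walkSem_permCongr_symm_apply {α β : Type} (e : α ≃ β) (p : Equiv.Perm α) (y : β) :
    (e.permCongr p).symm y = e (p.symm (e.symm y)) := rfl

/-- Value of the successor along the cycle (`finRotate`). [folklore] -/
theorem walkSem_val_finRotate (κ : Fin (2 ^ d)) :
    ((finRotate (2 ^ d) κ : Fin (2 ^ d)) : ℕ) = ((κ : ℕ) + 1) % 2 ^ d := by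
  rw [finRotate_apply, Fin.val_add, Fin.val_one', Nat.add_mod_mod]

/-- Value of the predecessor along the cycle (`finRotate⁻¹`). [folklore] -/
theorem walkSem_val_finRotate_symm (κ : Fin (2 ^ d)) :
    (((finRotate (2 ^ d)).symm κ : Fin (2 ^ d)) : ℕ) = ((κ : ℕ) + 2 ^ d - 1) % 2 ^ d := by
  rw [finRotate_symm_apply, Fin.val_sub, Fin.val_one']
  rcases Nat.eq_zero_or_pos d with rfl | hd
  · simp [Nat.mod_one]
  · rw [Nat.mod_eq_of_lt (Nat.one_lt_two_pow_iff.2 hd.ne')]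
    congr 1
    have := κ.isLt
    omega

/-! ### §3 Labels: fields and the neighbour labels -/

/-- The three fields of a label read by layer C: side bit, depth, position. [folklore] -/
theorem walkSem_label_fields (v : Vertex d) :
    (label d v).headD false = v.1 ∧ labDepth d (label d v) = depth v ∧ labIdx d (label d v) = idx v := by
  refine ⟨rfl, ?_, ?_⟩
  · have e : ((label d v).drop 1).take (d + 1) = bitsOf (d + 1) (depth v) := by
      simp [label, List.take_left', depth]
    rw [labDepth, e, walkSem_bitsToNat_bitsOf ((Nat.lt_succ_of_le (depth_le v)).trans Nat.lt_two_pow_self)]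
  · have e : ((label d v).drop (d + 2)).take (d + 1) = bitsOf (d + 1) (idx v) := by
      rw [label, show d + 2 = d + 1 + 1 from rfl, List.drop_succ_cons, List.drop_left' (length_bitsOf _ _),
        List.take_of_length_le (length_bitsOf _ _).le]
      rfl
    rw [labIdx, e, walkSem_bitsToNat_bitsOf
      ((idx_lt v).trans_le (Nat.pow_le_pow_right two_pos (Nat.le_succ_of_le (depth_le v))))]

/-- `mkLabel` at the fields of a vertex is its label. [folklore] -/
theorem walkSem_mkLabel_eq (w : Vertex d) : mkLabel d w.1 (depth w) (idx w) = label d w := rfl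

/-- **The neighbour labels computed by layer C** at the label of `v`, with the two cross positions in `p₂ p₃` at
a leaf, are the labels of: the parent (unless `v` is a root), then the two children (inner vertex) or the two
cross neighbours `cross₁ σ v`, `cross₂ σ v` (leaf). [cite: ChildsEtAl2003, §2] -/
theorem walkSem_nbrLabels (σ : CycleDatum d) (v : Vertex d) (p₂ p₃ : List Bool)
    (h₂ : depth v = d → bitsToNat p₂ = idx (cross₁ σ v)) (h₃ : depth v = d → bitsToNat p₃ = idx (cross₂ σ v)) :
    nbrLabels d (label d v) p₂ p₃ =
      ((if depth v = 0 then [] else [parentV v]) ++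
        (if depth v < d then [childV v false, childV v true] else [cross₁ σ v, cross₂ σ v])).map (label d) := by
  obtain ⟨h1, hj, hi⟩ := walkSem_label_fields v
  simp only [nbrLabels, h1, hj, hi, List.map_append]
  congr 1
  · by_cases h0 : depth v = 0
    · rw [if_pos h0, if_pos h0, List.map_nil]
    · rw [if_neg h0, if_neg h0]
      rfl
  · rcases Nat.lt_or_ge (depth v) d with hlt | hge
    · rw [if_neg hlt.ne, if_pos hlt]
      simp only [List.map_cons, List.map_nil, childV, dif_pos hlt]
      rfl
    · have hv : depth v = d := le_antisymm (depth_le v) hge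
      rw [if_pos hv, if_neg (not_lt.2 hge), List.map_cons, List.map_cons, List.map_nil, h₂ hv, h₃ hv,
        ← walkSem_mkLabel_eq (cross₁ σ v), ← walkSem_mkLabel_eq (cross₂ σ v), cross₁_fst hv, cross₂_fst hv,
        depth_cross₁ hv, depth_cross₂ hv]

/-- The neighbour list has at most three entries. [folklore] -/
theorem walkSem_nbrList_length (σ : CycleDatum d) (v : Vertex d) :
    ((if depth v = 0 then [] else [parentV v]) ++
        (if depth v < d then [childV v false, childV v true] else [cross₁ σ v, cross₂ σ v])).length ≤ 3 := by
  rw [List.length_append]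
  split_ifs <;> simp

/-! ### §4 Reading the cycle atom of a leaf by three permutation requests -/

section Atom

variable {μ : ℕ} (T : CodeSpace μ)

/-- **Right leaf `ι`**: the answers to `prpBodies d true ι` over the specification of layer B are, in value, the
positions `k = f⁻¹ ι`, `e k`, `e (k + 1)` — the two LEFT cross neighbours `crossL (codeCycle T d) ι`.
[cite: ChildsEtAl2003, §2] -/
theorem walkSem_atom_leafR (d : ℕ) (ι : Fin (2 ^ d)) (p₁ p₂ p₃ : List Bool)
    (h₁ : p₁ = primSpec μ d T ((prpBodies d true ι []).getD 0 []))
    (h₂ : p₂ = primSpec μ d T ((prpBodies d true ι p₁).getD 1 []))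
    (h₃ : p₃ = primSpec μ d T ((prpBodies d true ι p₁).getD 2 [])) :
    bitsToNat p₂ = ((crossL (codeCycle T d) ι).1 : ℕ) ∧ bitsToNat p₃ = ((crossL (codeCycle T d) ι).2 : ℕ) := by
  have hp₁ : p₁ = List.ofFn ((prp (tabScheme T) μ (tkey 3) d).symm ((bitVecEquiv d).symm ι)) := by
    rw [h₁]
    show List.ofFn ((prp (tabScheme T) μ (tkey 3) d).symm (vecOf d (bitsOf d ι))) = _
    rw [walkSem_vecOf_bitsOf_fin]
  have hp₂ : p₂ = List.ofFn (prp (tabScheme T) μ (tkey 2) d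
      ((prp (tabScheme T) μ (tkey 3) d).symm ((bitVecEquiv d).symm ι))) := by
    rw [h₂]
    show List.ofFn (prp (tabScheme T) μ (tkey 2) d (vecOf d p₁)) = _
    rw [hp₁, vecOf_ofFn]
  have hp₃ : p₃ = List.ofFn (prp (tabScheme T) μ (tkey 2) d ((bitVecEquiv d).symm (finRotate (2 ^ d)
      (bitVecEquiv d ((prp (tabScheme T) μ (tkey 3) d).symm ((bitVecEquiv d).symm ι)))))) := by
    rw [h₃]
    show List.ofFn (prp (tabScheme T) μ (tkey 2) d (vecOf d (bitsOf d ((bitsToNat p₁ + 1) % 2 ^ d)))) = _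
    rw [hp₁, ← walkSem_val_bitVecEquiv, ← walkSem_val_finRotate, walkSem_vecOf_bitsOf_fin]
  refine ⟨?_, ?_⟩
  · rw [hp₂, ← walkSem_val_bitVecEquiv]
    simp only [codeCycle, cycleOf, crossL, leafPerm, walkSem_permCongr_symm_apply, Equiv.permCongr_apply,
      Equiv.symm_apply_apply]
  · rw [hp₃, ← walkSem_val_bitVecEquiv]
    simp only [codeCycle, cycleOf, crossL, leafPerm, walkSem_permCongr_symm_apply, Equiv.permCongr_apply,
      Equiv.symm_apply_apply]

/-- **Left leaf `ι`**: the answers to `prpBodies d false ι` are, in value, `k = e⁻¹ ι`, `f k`, `f (k − 1)` — the two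
RIGHT cross neighbours `crossR (codeCycle T d) ι`. [cite: ChildsEtAl2003, §2] -/
theorem walkSem_atom_leafL (d : ℕ) (ι : Fin (2 ^ d)) (p₁ p₂ p₃ : List Bool)
    (h₁ : p₁ = primSpec μ d T ((prpBodies d false ι []).getD 0 []))
    (h₂ : p₂ = primSpec μ d T ((prpBodies d false ι p₁).getD 1 []))
    (h₃ : p₃ = primSpec μ d T ((prpBodies d false ι p₁).getD 2 [])) :
    bitsToNat p₂ = ((crossR (codeCycle T d) ι).1 : ℕ) ∧ bitsToNat p₃ = ((crossR (codeCycle T d) ι).2 : ℕ) := by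
  have hp₁ : p₁ = List.ofFn ((prp (tabScheme T) μ (tkey 2) d).symm ((bitVecEquiv d).symm ι)) := by
    rw [h₁]
    show List.ofFn ((prp (tabScheme T) μ (tkey 2) d).symm (vecOf d (bitsOf d ι))) = _
    rw [walkSem_vecOf_bitsOf_fin]
  have hp₂ : p₂ = List.ofFn (prp (tabScheme T) μ (tkey 3) d
      ((prp (tabScheme T) μ (tkey 2) d).symm ((bitVecEquiv d).symm ι))) := by
    rw [h₂]
    show List.ofFn (prp (tabScheme T) μ (tkey 3) d (vecOf d p₁)) = _
    rw [hp₁, vecOf_ofFn]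
  have hp₃ : p₃ = List.ofFn (prp (tabScheme T) μ (tkey 3) d ((bitVecEquiv d).symm ((finRotate (2 ^ d)).symm
      (bitVecEquiv d ((prp (tabScheme T) μ (tkey 2) d).symm ((bitVecEquiv d).symm ι)))))) := by
    rw [h₃]
    show List.ofFn (prp (tabScheme T) μ (tkey 3) d (vecOf d (bitsOf d ((bitsToNat p₁ + 2 ^ d - 1) % 2 ^ d)))) = _
    rw [hp₁, ← walkSem_val_bitVecEquiv, ← walkSem_val_finRotate_symm, walkSem_vecOf_bitsOf_fin]
  refine ⟨?_, ?_⟩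
  · rw [hp₂, ← walkSem_val_bitVecEquiv]
    simp only [codeCycle, cycleOf, crossR, leafPerm, walkSem_permCongr_symm_apply, Equiv.permCongr_apply,
      Equiv.symm_apply_apply]
  · rw [hp₃, ← walkSem_val_bitVecEquiv]
    simp only [codeCycle, cycleOf, crossR, leafPerm, walkSem_permCongr_symm_apply, Equiv.permCongr_apply,
      Equiv.symm_apply_apply]

/-- **The cycle atom of a leaf**: at a leaf `v`, the second and third permutation answers of `prpBodies` carry the
positions of the two cross neighbours `cross₁ (codeCycle T d) v`, `cross₂ (codeCycle T d) v`.
[cite: ChildsEtAl2003, §2] -/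
theorem walkSem_atom (d : ℕ) {v : Vertex d} (hv : depth v = d) (p₁ p₂ p₃ : List Bool)
    (h₁ : p₁ = primSpec μ d T ((prpBodies d v.1 (idx v) []).getD 0 []))
    (h₂ : p₂ = primSpec μ d T ((prpBodies d v.1 (idx v) p₁).getD 1 []))
    (h₃ : p₃ = primSpec μ d T ((prpBodies d v.1 (idx v) p₁).getD 2 [])) :
    bitsToNat p₂ = idx (cross₁ (codeCycle T d) v) ∧ bitsToNat p₃ = idx (cross₂ (codeCycle T d) v) := by
  obtain ⟨ι, rfl | rfl⟩ := exists_eq_leaf hv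
  · rw [cross₁_leafL, cross₂_leafL, idx_leafR, idx_leafR]
    exact walkSem_atom_leafL T d ι p₁ p₂ p₃ h₁ h₂ h₃
  · rw [cross₁_leafR, cross₂_leafR, idx_leafL, idx_leafL]
    exact walkSem_atom_leafR T d ι p₁ p₂ p₃ h₁ h₂ h₃

end Atom

/-! ### §5 Sorting by binary value (the registered toolkit stub) -/

/-- `insertByVal` is Mathlib's ordered insertion for the binary-value preorder. [folklore] -/
theorem walkSem_insertByVal (u : List Bool) (l : List (List Bool)) :
    insertByVal u l = l.orderedInsert (fun a b => bitsToNat a ≤ bitsToNat b) u := by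
  induction l with
  | nil => rfl
  | cons v vs ih => simp only [insertByVal, List.orderedInsert_cons, ih]

/-- **Registered toolkit stub of crux stmt-QuantumAdvantage-2340** (aux of `stub_walkSem`): layer C's `sortByVal` is
insertion sort by increasing binary value. [folklore] -/
theorem toolkit_phWalkSemAux :
    ∀ l : List (List Bool), sortByVal l = l.insertionSort (fun a b => bitsToNat a ≤ bitsToNat b) := by
  intro l
  induction l with
  | nil => rfl
  | cons u us ih => rw [sortByVal, ih, walkSem_insertByVal, List.insertionSort_cons]

/-! ### §6 The glued-trees oracle at honest and dishonest names; query halves; the all-invalid answer -/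

/-- The neighbour list enumerates the neighbourhood of `v` without repetition (`1 ≤ d`; adapted from toolkit
`NbrBitFP`, piece G5). [cite: ChildsEtAl2003, §2] -/
theorem walkSem_nbrList (hd : 1 ≤ d) (σ : CycleDatum d) (v : Vertex d) :
    ((if depth v = 0 then [] else [parentV v]) ++
        (if depth v < d then [childV v false, childV v true] else [cross₁ σ v, cross₂ σ v])).toFinset =
      (graph d σ).neighborFinset v ∧
    ((if depth v = 0 then [] else [parentV v]) ++
        (if depth v < d then [childV v false, childV v true] else [cross₁ σ v, cross₂ σ v])).Nodup := by
  by_cases hv : depth v < d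
  · have hpc : ∀ b, parentV v ≠ childV v b := fun b h => by
      have := congrArg depth h; rw [depth_childV hv, depth_parentV] at this; omega
    have hcc := childV_false_ne_true hv
    rw [neighborFinset_of_depth_lt σ hv, if_pos hv]
    by_cases h0 : depth v = 0
    · rw [if_pos h0, if_pos h0]; simp [hcc]
    · rw [if_neg h0, if_neg h0]; simp [hcc, hpc]; exact Finset.insert_comm _ _ _
  · have hv' : depth v = d := le_antisymm (depth_le v) (not_lt.mp hv)
    have h12 := cross₁_ne_cross₂ hd σ hv'
    have hp1 := parentV_ne_cross₁ (σ := σ) hv'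
    have hp2 := parentV_ne_cross₂ (σ := σ) hv'
    have h0 : depth v ≠ 0 := by omega
    rw [neighborFinset_of_depth_eq hd σ hv', if_neg hv, if_neg h0]
    simp [h12, hp1, hp2]

/-- A duplicate-free list of vertices, named and insertion-sorted by binary value, is the `nameVal`-sorted
enumeration of the name set read back as strings (adapted from toolkit `NbrBitFP`, piece G5). [folklore] -/
theorem walkSem_sort_names {α : Type} [DecidableEq α] {N : ℕ} (ν : α ↪ (Fin N → Bool)) {L : List α}
    (hL : L.Nodup) :
    (L.map fun w => List.ofFn (ν w)).insertionSort (fun a b => bitsToNat a ≤ bitsToNat b) =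
      (((L.toFinset.map ν).image nameVal).sort (· ≤ ·)).map fun m => List.ofFn (nameOfVal N m) := by
  set g : ℕ → List Bool := fun m => List.ofFn (nameOfVal N m) with hg
  set val : α → ℕ := fun w => nameVal (ν w) with hval
  have hinj : Function.Injective val := fun a b h => ν.injective (nameVal_injective h)
  have h1 : (L.map fun w => List.ofFn (ν w)) = (L.map val).map g := by
    rw [List.map_map]
    exact List.map_congr_left fun w _ => by simp [hg, hval, nameOfVal_nameVal]
  have h2 : ((L.map val).insertionSort (· ≤ ·)).map g =
      ((L.map val).map g).insertionSort (fun a b => bitsToNat a ≤ bitsToNat b) :=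
    List.map_insertionSort (r := (· ≤ ·)) (s := fun a b => bitsToNat a ≤ bitsToNat b) g _ fun a ha b hb => by
      obtain ⟨w, -, rfl⟩ := List.mem_map.1 ha
      obtain ⟨w', -, rfl⟩ := List.mem_map.1 hb
      simp [hg, hval, nameOfVal_nameVal, walkSem_bitsToNat_ofFn]
  have hnd : ((L.map val).insertionSort (· ≤ ·)).Nodup :=
    (List.perm_insertionSort _ _).nodup_iff.2 (hL.map hinj)
  have hT : ((L.map val).insertionSort (· ≤ ·)).toFinset = (L.toFinset.map ν).image nameVal := by
    ext m
    simp [hval, List.mem_insertionSort]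
  rw [h1, ← h2, ← hT]
  exact congrArg _ ((List.toFinset_sort (r := (· ≤ ·)) hnd).2 (List.pairwise_insertionSort _ _)).symm

/-- The neighbour-name set at the name of a vertex is the image of its neighbourhood. [cite: ChildsEtAl2003, §4 Game 1] -/
theorem walkSem_nbrNames_naming {N : ℕ} (σ : CycleDatum d) (ν : Vertex d ↪ (Fin N → Bool)) (v : Vertex d) :
    nbrNames σ ν (ν v) = ((graph d σ).neighborFinset v).map ν := by
  unfold nbrNames
  have : (Finset.univ.filter fun w => ν w = ν v) = {v} := by
    ext w; simp [ν.injective.eq_iff]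
  rw [this, Finset.singleton_biUnion]

/-- At a string naming no vertex the oracle lists nothing. [cite: ChildsEtAl2003, §4 Game 1] -/
theorem walkSem_oracle_none {N : ℕ} (σ : CycleDatum d) (ν : Vertex d ↪ (Fin N → Bool)) {a : Fin N → Bool}
    (h : ∀ v, ν v ≠ a) : gluedTreesOracle σ ν a = [] := by
  have hfil : (Finset.univ.filter fun w => ν w = a) = ∅ :=
    Finset.filter_eq_empty_iff.2 fun w _ hw => h w hw
  unfold gluedTreesOracle GluedTrees.nbrNames
  rw [hfil, Finset.biUnion_empty, Finset.image_empty, Finset.sort_empty, List.map_nil]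

/-- At the name of `v` the oracle, listed as strings, is the insertion sort by binary value of the SIV
encryptions of the neighbour labels of `v` (`1 ≤ d`). [cite: ChildsEtAl2003, §2 and §4 Game 1] -/
theorem walkSem_oracle_some (hd : 1 ≤ d) (σ : CycleDatum d) (P : PuncturablePRFScheme) (μ : ℕ)
    (k₁ k₂ : List Bool) (v : Vertex d) :
    (gluedTreesOracle σ (naming P μ k₁ k₂ d) (naming P μ k₁ k₂ d v)).map List.ofFn =
      ((((if depth v = 0 then [] else [parentV v]) ++
          (if depth v < d then [childV v false, childV v true] else [cross₁ σ v, cross₂ σ v])).map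
          (label d)).map (sivEnc P μ k₁ k₂)).insertionSort
        fun a b => bitsToNat a ≤ bitsToNat b := by
  obtain ⟨hT, hnd⟩ := walkSem_nbrList hd σ v
  rw [gluedTreesOracle, walkSem_nbrNames_naming, ← hT, List.map_map, List.map_map,
    List.map_congr_left (f := sivEnc P μ k₁ k₂ ∘ label d)
      (g := fun w => List.ofFn (naming P μ k₁ k₂ d w)) fun w _ => (ofFn_naming P μ k₁ k₂ d w).symm,
    walkSem_sort_names _ hnd]
  rfl

/-- The first half of a `2N`-bit query, listed. [folklore] -/
theorem walkSem_ofFn_castAdd {N : ℕ} {q : List Bool} (h : q.length = N + N) :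
    List.ofFn (fun i : Fin N => q.get ((Fin.castAdd N i).cast h.symm)) = q.take N := by
  refine List.ext_getElem (by rw [List.length_ofFn, List.length_take, h]; omega) fun i h₁ h₂ => ?_
  simp

/-- The second half of a `2N`-bit query, listed. [folklore] -/
theorem walkSem_ofFn_natAdd {N : ℕ} {q : List Bool} (h : q.length = N + N) :
    List.ofFn (fun i : Fin N => q.get ((Fin.natAdd N i).cast h.symm)) = q.drop N := by
  refine List.ext_getElem (by rw [List.length_ofFn, List.length_drop, h]; omega) fun i h₁ h₂ => ?_
  simp [Nat.add_comm]

/-- The all-invalid answer string has no `1` bit. [folklore] -/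
theorem walkSem_answerBits_getD_of_nil {N : ℕ} (σ : CycleDatum d) (ν : Vertex d ↪ (Fin N → Bool))
    {a : Fin N → Bool} (h : gluedTreesOracle σ ν a = []) (t : ℕ) : (answerBits σ ν a).getD t false = false := by
  have h0 : bitsOf 2 0 = List.replicate 2 false := by simp [bitsOf]
  rw [answerBits, h, List.length_nil, h0, List.map_nil, List.flatten_nil, List.append_nil, fit,
    List.replicate_append_replicate, List.take_replicate, List.getD_eq_getElem?_getD,
    List.getElem?_getD_replicate_default_eq]

end Summit.QuantumAdvantage.QuantumAdvantage.Theorems.WbwObfuscatedGluedTrees.KnowledgeOfWalk.PrfHybrid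

end
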